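import Mathlib

/-!
# Chernoff tails for integer-current weights from the tilted partition sum (K16, solo-blind s21)

For a non-negative weight `W : ℤ → ℝ`, the tilted partition sum
`tiltedSum W ψ = ∑' m, W m * exp (-(m * ψ))` dominates each of its terms, so
`W n ≤ exp (n * ψ) * tiltedSum W ψ` for every tilt `ψ` at which the sum converges
(Markov/Chernoff).  If moreover the log-moment-generating function is at most quadratic
on the tilt window, `tiltedSum W (-t) ≤ tiltedSum W 0 * exp (C * β * t ^ 2 / 2)`, then
beyond the current window, `C * β * t ≤ n`, the weight decays exponentially:
`W n ≤ tiltedSum W 0 * exp (-(n * t / 2))`.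

This is clause (LF-0) of `interpolation.md` §12 (solo-blind notes): large coarse currents
are rare for free once the windowed ellipticity bound `|Λ''| ≤ C β` holds; no separate
large-field hypothesis on single weights is needed.
-/

namespace Summit.AtomisticToContinuum.BoseEinsteinCondensation.Theorems

/-- The tilted partition sum `∑' m, W m * exp (-(m ψ))` of a weight on `ℤ`. -/
noncomputable def tiltedSum (W : ℤ → ℝ) (ψ : ℝ) : ℝ :=
  ∑' m : ℤ, W m * Real.exp (-((m : ℝ) * ψ))

/-- At zero tilt the tilted sum is the total mass. -/
theorem tiltedSum_zero (W : ℤ → ℝ) : tiltedSum W 0 = ∑' m : ℤ, W m := by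
  simp [tiltedSum]

/-- The tilted sum of a non-negative weight is non-negative. -/
theorem tiltedSum_nonneg (W : ℤ → ℝ) (hW : ∀ m, 0 ≤ W m) (ψ : ℝ) : 0 ≤ tiltedSum W ψ :=
  tsum_nonneg fun m => mul_nonneg (hW m) (Real.exp_nonneg _)

/-- Markov/Chernoff: a single term is bounded by the tilted sum. -/
theorem weight_le_exp_mul_tiltedSum (W : ℤ → ℝ) (hW : ∀ m, 0 ≤ W m) (ψ : ℝ)
    (hs : Summable fun m : ℤ => W m * Real.exp (-((m : ℝ) * ψ))) (n : ℤ) :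
    W n ≤ Real.exp ((n : ℝ) * ψ) * tiltedSum W ψ := by
  have h1 : W n * Real.exp (-((n : ℝ) * ψ)) ≤ tiltedSum W ψ := by
    unfold tiltedSum
    exact hs.le_tsum n (fun m _ => mul_nonneg (hW m) (Real.exp_nonneg _))
  have hpos : 0 < Real.exp ((n : ℝ) * ψ) := Real.exp_pos _
  have h2 : W n = Real.exp ((n : ℝ) * ψ) * (W n * Real.exp (-((n : ℝ) * ψ))) := by
    rw [Real.exp_neg]
    field_simp
  calc W n = Real.exp ((n : ℝ) * ψ) * (W n * Real.exp (-((n : ℝ) * ψ))) := h2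
    _ ≤ Real.exp ((n : ℝ) * ψ) * tiltedSum W ψ := mul_le_mul_of_nonneg_left h1 hpos.le

/-- Chernoff tail beyond the current window: if the tilted sum at tilt `-t` is controlled
by the quadratic (ellipticity) bound `exp (C β t² / 2)` relative to the untilted sum, then
`W n ≤ tiltedSum W 0 * exp (-(n t / 2))` for all `n ≥ C β t`. -/
theorem weight_chernoff_tail (W : ℤ → ℝ) (hW : ∀ m, 0 ≤ W m) {t C β : ℝ} (ht : 0 ≤ t)
    (hs : Summable fun m : ℤ => W m * Real.exp (-((m : ℝ) * (-t))))
    (hmgf : tiltedSum W (-t) ≤ tiltedSum W 0 * Real.exp (C * β * t ^ 2 / 2))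
    (n : ℤ) (hn : C * β * t ≤ (n : ℝ)) :
    W n ≤ tiltedSum W 0 * Real.exp (-((n : ℝ) * t / 2)) := by
  have hZ0 : 0 ≤ tiltedSum W 0 := tiltedSum_nonneg W hW 0
  have h1 := weight_le_exp_mul_tiltedSum W hW (-t) hs n
  have h2 : W n ≤ Real.exp ((n : ℝ) * (-t)) * (tiltedSum W 0 * Real.exp (C * β * t ^ 2 / 2)) :=
    h1.trans (mul_le_mul_of_nonneg_left hmgf (Real.exp_pos _).le)
  have h3 : Real.exp ((n : ℝ) * (-t)) * (tiltedSum W 0 * Real.exp (C * β * t ^ 2 / 2))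
      = tiltedSum W 0 * Real.exp (-((n : ℝ) * t) + C * β * t ^ 2 / 2) := by
    rw [Real.exp_add]; ring_nf
  rw [h3] at h2
  have hexp : Real.exp (-((n : ℝ) * t) + C * β * t ^ 2 / 2) ≤ Real.exp (-((n : ℝ) * t / 2)) := by
    apply Real.exp_le_exp.mpr
    have : C * β * t ^ 2 / 2 ≤ (n : ℝ) * t / 2 := by
      have hmul : C * β * t * t ≤ (n : ℝ) * t := mul_le_mul_of_nonneg_right hn ht
      nlinarith
    linarith
  exact h2.trans (mul_le_mul_of_nonneg_left hexp hZ0)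

/-- Symmetric form for even weights: the same tail bound for `-n`. -/
theorem weight_chernoff_tail_neg (W : ℤ → ℝ) (hW : ∀ m, 0 ≤ W m) (heven : ∀ m, W (-m) = W m)
    {t C β : ℝ} (ht : 0 ≤ t)
    (hs : Summable fun m : ℤ => W m * Real.exp (-((m : ℝ) * (-t))))
    (hmgf : tiltedSum W (-t) ≤ tiltedSum W 0 * Real.exp (C * β * t ^ 2 / 2))
    (n : ℤ) (hn : C * β * t ≤ (n : ℝ)) :
    W (-n) ≤ tiltedSum W 0 * Real.exp (-((n : ℝ) * t / 2)) := by
  rw [heven]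
  exact weight_chernoff_tail W hW ht hs hmgf n hn

end Summit.AtomisticToContinuum.BoseEinsteinCondensation.Theorems
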